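import Summits.ValiantsHypothesis.ValiantsHypothesis.Theses.ProjectionRigidity

/-!
# Crux `ProjOptimalUnique` (stmt-ValiantsHypothesis-16001) — load-bearing hypothesis No. 2: OPTIMALITY OF THE SIZE

Negative lemma for the crux `ProjectionRigidity.ProjOptimalUnique` (disprover seat, cycle 1).

The crux pins the size of the two pure projections `A, B` of `DET` with `det = per_n` to the optimal
value `m = pdc(per_n)`.  This is load-bearing: `ProjOptimalUniqueWithoutOptimality` — the same
uniqueness claimed at EVERY size `m` — is false, already at `n = 3`, `m = 8 = pdc(per₃) + 1`, and
already for binary (`0 / 1 / variable`) matrices.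

Witness.  `A₈ = G ⊕ 1` (Grenet's `7 × 7` branching-program matrix `G` of `per₃`, rows/columns
`s, u₀, u₁, u₂, v₀, v₁, v₂`, padded by a unit diagonal cell `z`) and `B₈ =` the same matrix with the
dead cell `(s, z)` filled by the variable `X (2,1)`.  Laplace expansion along the unit row `z` gives
`det A₈ = det B₈ = det G = per₃` (the column above the unit pivot is invisible to the determinant);
`det G = per₃` is computed through the unipotent factorisation `G · E₁ · E₂ = T` (upper triangular,
corner `per₃`) exactly as in the tree's `GrenetRigidityOptimalUniqueThree_refuted`.  Invariant: the
coefficient matrix of `X (2,1)` in `B₈` has the invertible `3 × 3` minor (rows `s, u₀, u₁`, columns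
`z, v₁, v₀`), i.e. rank `3`, whereas every coefficient matrix of `A₈` has at most two non-zero rows
(rank `≤ 2`); every `γ ∈ permSymmetrySubst ℂ 3` is a MONOMIAL substitution of the nine variables, so
the coefficient matrices of `P · A₈(γx) · Q` and of `P · A₈(γx)ᵀ · Q` are `P · (c • A₈,w) · Q`, of
rank `≤ 2` — contradiction.

Why this matters for provers: uniqueness of pure optimal projections can only come from the absence
of a spare vertex.  Besides this cheap dead-cell witness, the disprover's `Disproof.lean` records a
TAUT second orbit at size 8 (no dead cell: Grenet plus one parity vertex purifying the lead's signed
twist `T`), so "no junk" alone does not rescue uniqueness at `m = pdc + 1` either.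

Monomiality of `permSymmetrySubst` and the coefficient-matrix calculus are adapted from
`Theorems/GrenetRigidityOptimalUniqueRefutation.lean`; all auxiliary facts are `have`s inside the
theorem (files on the negative lane carry no positive conclusion about a Theses declaration).
-/

noncomputable section

-- single-conjunct layout: Sub = Summit, duplicated namespace component intended
set_option linter.dupNamespace false

namespace Summit.ValiantsHypothesis.ValiantsHypothesis.Theorems.ProjOptimalUnique.Negative

open MvPolynomial Matrix
open scoped Kronecker
open Literature.Computability.AlgebraicComplexity

/-- `ProjOptimalUnique` WITHOUT the optimality of the size: the uniqueness of pure projections of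
`DET` with `det = per_n` up to `GL × GL × permSymmetrySubst × ᵀ`, claimed at every size `m` (the crux
is the case `m = pdc(per_n)`); hypotheses and conclusion otherwise verbatim. -/
def ProjOptimalUniqueWithoutOptimality : Prop :=
  ∀ n ≥ 3, ∀ m : ℕ, ∀ A B : Matrix (Fin m) (Fin m) (MvPolynomial (Fin n × Fin n) ℂ),
    (∀ i j, (∃ v, A i j = MvPolynomial.X v) ∨ ∃ c, A i j = MvPolynomial.C c) →
    (∀ i j, (∃ v, B i j = MvPolynomial.X v) ∨ ∃ c, B i j = MvPolynomial.C c) →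
    A.det = perPoly (Fin n) ℂ → B.det = perPoly (Fin n) ℂ →
    ∃ (P Q : GL (Fin m) ℂ) (γ : GL (Fin n × Fin n) ℂ), γ ∈ permSymmetrySubst ℂ n ∧
      (B = (P : Matrix _ _ ℂ).map MvPolynomial.C * Matrix.linSubstEntries γ A *
          (Q : Matrix _ _ ℂ).map MvPolynomial.C ∨
       B = (P : Matrix _ _ ℂ).map MvPolynomial.C * (Matrix.linSubstEntries γ A).transpose *
          (Q : Matrix _ _ ℂ).map MvPolynomial.C)

-- one declaration inspecting all entries of several explicit `7 × 7` / `8 × 8` matrices at once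
set_option maxHeartbeats 1600000 in
/-- **Optimality of the size is load-bearing**: `ProjOptimalUniqueWithoutOptimality` is false
(`n = 3`, `m = 8`: Grenet ⊕ 1 versus Grenet ⊕ 1 with the dead cell `(s, z)` filled by `X (2,1)`;
separated by the rank of the `X (2,1)`-coefficient matrix, `3` versus `≤ 2`). -/
theorem projOptimalUnique_false_without_optimality : ¬ ProjOptimalUniqueWithoutOptimality := by
  intro hU
  -- ### the two 8 × 8 matrices `A₈ = G ⊕ 1`, `B₈`, and the unipotent factorisations
  -- `A₈ · E₁ · E₂ = T₈`, `B₈ · E₁ · E₂ = T₈'` (upper triangular, corner `per₃`)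
  obtain ⟨A8, hA8⟩ : ∃ M : Matrix (Fin 8) (Fin 8) (MvPolynomial (Fin 3 × Fin 3) ℂ), M =
      !![0, X (0,0), X (1,0), X (2,0), 0, 0, 0, 0;
         0, 1, 0, 0, 0, X (2,1), X (1,1), 0;
         0, 0, 1, 0, X (2,1), 0, X (0,1), 0;
         0, 0, 0, 1, X (1,1), X (0,1), 0, 0;
         X (0,2), 0, 0, 0, 1, 0, 0, 0;
         X (1,2), 0, 0, 0, 0, 1, 0, 0;
         X (2,2), 0, 0, 0, 0, 0, 1, 0;
         0, 0, 0, 0, 0, 0, 0, 1] := ⟨_, rfl⟩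
  obtain ⟨B8, hB8⟩ : ∃ M : Matrix (Fin 8) (Fin 8) (MvPolynomial (Fin 3 × Fin 3) ℂ), M =
      !![0, X (0,0), X (1,0), X (2,0), 0, 0, 0, X (2,1);
         0, 1, 0, 0, 0, X (2,1), X (1,1), 0;
         0, 0, 1, 0, X (2,1), 0, X (0,1), 0;
         0, 0, 0, 1, X (1,1), X (0,1), 0, 0;
         X (0,2), 0, 0, 0, 1, 0, 0, 0;
         X (1,2), 0, 0, 0, 0, 1, 0, 0;
         X (2,2), 0, 0, 0, 0, 0, 1, 0;
         0, 0, 0, 0, 0, 0, 0, 1] := ⟨_, rfl⟩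
  obtain ⟨E1, hE1⟩ : ∃ M : Matrix (Fin 8) (Fin 8) (MvPolynomial (Fin 3 × Fin 3) ℂ), M =
      !![1, 0, 0, 0, 0, 0, 0, 0;
         0, 1, 0, 0, 0, -X (2,1), -X (1,1), 0;
         0, 0, 1, 0, -X (2,1), 0, -X (0,1), 0;
         0, 0, 0, 1, -X (1,1), -X (0,1), 0, 0;
         0, 0, 0, 0, 1, 0, 0, 0;
         0, 0, 0, 0, 0, 1, 0, 0;
         0, 0, 0, 0, 0, 0, 1, 0;
         0, 0, 0, 0, 0, 0, 0, 1] := ⟨_, rfl⟩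
  obtain ⟨E2, hE2⟩ : ∃ M : Matrix (Fin 8) (Fin 8) (MvPolynomial (Fin 3 × Fin 3) ℂ), M =
      !![1, 0, 0, 0, 0, 0, 0, 0;
         0, 1, 0, 0, 0, 0, 0, 0;
         0, 0, 1, 0, 0, 0, 0, 0;
         0, 0, 0, 1, 0, 0, 0, 0;
         -X (0,2), 0, 0, 0, 1, 0, 0, 0;
         -X (1,2), 0, 0, 0, 0, 1, 0, 0;
         -X (2,2), 0, 0, 0, 0, 0, 1, 0;
         0, 0, 0, 0, 0, 0, 0, 1] := ⟨_, rfl⟩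
  obtain ⟨A1, hA1⟩ : ∃ M : Matrix (Fin 8) (Fin 8) (MvPolynomial (Fin 3 × Fin 3) ℂ), M =
      !![0, X (0,0), X (1,0), X (2,0), -(X (1,0) * X (2,1) + X (2,0) * X (1,1)),
           -(X (0,0) * X (2,1) + X (2,0) * X (0,1)), -(X (0,0) * X (1,1) + X (1,0) * X (0,1)), 0;
         0, 1, 0, 0, 0, 0, 0, 0;
         0, 0, 1, 0, 0, 0, 0, 0;
         0, 0, 0, 1, 0, 0, 0, 0;
         X (0,2), 0, 0, 0, 1, 0, 0, 0;
         X (1,2), 0, 0, 0, 0, 1, 0, 0;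
         X (2,2), 0, 0, 0, 0, 0, 1, 0;
         0, 0, 0, 0, 0, 0, 0, 1] := ⟨_, rfl⟩
  obtain ⟨B1, hB1⟩ : ∃ M : Matrix (Fin 8) (Fin 8) (MvPolynomial (Fin 3 × Fin 3) ℂ), M =
      !![0, X (0,0), X (1,0), X (2,0), -(X (1,0) * X (2,1) + X (2,0) * X (1,1)),
           -(X (0,0) * X (2,1) + X (2,0) * X (0,1)), -(X (0,0) * X (1,1) + X (1,0) * X (0,1)), X (2,1);
         0, 1, 0, 0, 0, 0, 0, 0;
         0, 0, 1, 0, 0, 0, 0, 0;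
         0, 0, 0, 1, 0, 0, 0, 0;
         X (0,2), 0, 0, 0, 1, 0, 0, 0;
         X (1,2), 0, 0, 0, 0, 1, 0, 0;
         X (2,2), 0, 0, 0, 0, 0, 1, 0;
         0, 0, 0, 0, 0, 0, 0, 1] := ⟨_, rfl⟩
  obtain ⟨T8, hT8⟩ : ∃ M : Matrix (Fin 8) (Fin 8) (MvPolynomial (Fin 3 × Fin 3) ℂ), M =
      !![perPoly (Fin 3) ℂ, X (0,0), X (1,0), X (2,0), -(X (1,0) * X (2,1) + X (2,0) * X (1,1)),
           -(X (0,0) * X (2,1) + X (2,0) * X (0,1)), -(X (0,0) * X (1,1) + X (1,0) * X (0,1)), 0;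
         0, 1, 0, 0, 0, 0, 0, 0;
         0, 0, 1, 0, 0, 0, 0, 0;
         0, 0, 0, 1, 0, 0, 0, 0;
         0, 0, 0, 0, 1, 0, 0, 0;
         0, 0, 0, 0, 0, 1, 0, 0;
         0, 0, 0, 0, 0, 0, 1, 0;
         0, 0, 0, 0, 0, 0, 0, 1] := ⟨_, rfl⟩
  obtain ⟨U8, hU8⟩ : ∃ M : Matrix (Fin 8) (Fin 8) (MvPolynomial (Fin 3 × Fin 3) ℂ), M =
      !![perPoly (Fin 3) ℂ, X (0,0), X (1,0), X (2,0), -(X (1,0) * X (2,1) + X (2,0) * X (1,1)),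
           -(X (0,0) * X (2,1) + X (2,0) * X (0,1)), -(X (0,0) * X (1,1) + X (1,0) * X (0,1)), X (2,1);
         0, 1, 0, 0, 0, 0, 0, 0;
         0, 0, 1, 0, 0, 0, 0, 0;
         0, 0, 0, 1, 0, 0, 0, 0;
         0, 0, 0, 0, 1, 0, 0, 0;
         0, 0, 0, 0, 0, 1, 0, 0;
         0, 0, 0, 0, 0, 0, 1, 0;
         0, 0, 0, 0, 0, 0, 0, 1] := ⟨_, rfl⟩
  have p3 : perPoly (Fin 3) ℂ = X (0,0) * (X (1,1) * X (2,2) + X (2,1) * X (1,2))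
      + X (1,0) * (X (0,1) * X (2,2) + X (2,1) * X (0,2))
      + X (2,0) * (X (0,1) * X (1,2) + X (1,1) * X (0,2)) := by
    rw [perPoly, Matrix.permanent_fin_three_row]
    simp only [Matrix.mvPolynomialX_apply]
    ring
  have coeff_one_single : ∀ v : Fin 3 × Fin 3,
      (1 : MvPolynomial (Fin 3 × Fin 3) ℂ).coeff (Finsupp.single v 1) = 0 := fun v => by
    rw [MvPolynomial.coeff_one, if_neg]
    exact Ne.symm (Finsupp.single_ne_zero.mpr one_ne_zero)
  -- ### ONE inspection of the 64 entries: products, triangularity, shapes, and the (at most two)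
  -- rows in which the variable `X w` occurs in `A₈`
  have big8 : ∀ i j : Fin 8,
      ((A8 * E1) i j = A1 i j ∧ (A1 * E2) i j = T8 i j ∧ (B8 * E1) i j = B1 i j ∧
        (B1 * E2) i j = U8 i j) ∧
      ((j < i → E1 i j = 0) ∧ (j < i → T8 i j = 0) ∧ (j < i → U8 i j = 0) ∧ (i < j → E2 i j = 0)) ∧
      ((A8 i j = 0 ∨ A8 i j = 1 ∨ ∃ w, A8 i j = X w) ∧ (B8 i j = 0 ∨ B8 i j = 1 ∨ ∃ w, B8 i j = X w)) ∧
      (∀ w : Fin 3 × Fin 3, (A8 i j).coeff (Finsupp.single w 1) ≠ 0 →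
        i = ![![(0 : Fin 8), 2, 4], ![0, 1, 5], ![0, 1, 6]] w.1 w.2 ∨
        i = ![![(1 : Fin 8), 3, 5], ![2, 3, 4], ![3, 2, 5]] w.1 w.2) := by
    intro i j
    rw [hA8, hB8, hE1, hE2, hA1, hB1, hT8, hU8, p3]
    fin_cases i <;> fin_cases j <;> refine ⟨⟨?_, ?_, ?_, ?_⟩, ⟨?_, ?_, ?_, ?_⟩, ⟨?_, ?_⟩, ?_⟩ <;>
      simp [Matrix.mul_apply, Fin.sum_univ_eight, MvPolynomial.coeff_X, Finsupp.single_left_inj,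
        coeff_one_single]
    all_goals ring
  -- ### determinants and purity of the two representations
  have dE1 : E1.det = 1 := by
    rw [Matrix.det_of_upperTriangular (M := E1) fun i j hij => (big8 i j).2.1.1 hij,
      Fin.prod_univ_eight, hE1]
    simp
  have dE2 : E2.det = 1 := by
    rw [Matrix.det_of_lowerTriangular E2 (fun i j hij => (big8 i j).2.1.2.2.2 hij),
      Fin.prod_univ_eight, hE2]
    simp
  have det_A8 : A8.det = perPoly (Fin 3) ℂ := by
    have h1 : A8 * E1 = A1 := Matrix.ext fun i j => (big8 i j).1.1
    have h2 : A1 * E2 = T8 := Matrix.ext fun i j => (big8 i j).1.2.1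
    have dT : T8.det = perPoly (Fin 3) ℂ := by
      rw [Matrix.det_of_upperTriangular (M := T8) fun i j hij => (big8 i j).2.1.2.1 hij,
        Fin.prod_univ_eight, hT8]
      simp
    have h := congrArg Matrix.det h2
    rwa [← h1, Matrix.det_mul, Matrix.det_mul, dE1, dE2, dT, mul_one, mul_one] at h
  have det_B8 : B8.det = perPoly (Fin 3) ℂ := by
    have h1 : B8 * E1 = B1 := Matrix.ext fun i j => (big8 i j).1.2.2.1
    have h2 : B1 * E2 = U8 := Matrix.ext fun i j => (big8 i j).1.2.2.2
    have dU : U8.det = perPoly (Fin 3) ℂ := by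
      rw [Matrix.det_of_upperTriangular (M := U8) fun i j hij => (big8 i j).2.1.2.2.1 hij,
        Fin.prod_univ_eight, hU8]
      simp
    have h := congrArg Matrix.det h2
    rwa [← h1, Matrix.det_mul, Matrix.det_mul, dE1, dE2, dU, mul_one, mul_one] at h
  have pure_of_shape : ∀ {p : MvPolynomial (Fin 3 × Fin 3) ℂ}, (p = 0 ∨ p = 1 ∨ ∃ w, p = X w) →
      (∃ v, p = X v) ∨ ∃ c, p = C c := by
    rintro p (h | h | ⟨w, h⟩)
    · exact Or.inr ⟨0, by rw [h, map_zero]⟩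
    · exact Or.inr ⟨1, by rw [h, map_one]⟩
    · exact Or.inl ⟨w, h⟩
  have pure_A8 : ∀ i j, (∃ v, A8 i j = X v) ∨ ∃ c, A8 i j = C c :=
    fun i j => pure_of_shape (big8 i j).2.2.1.1
  have pure_B8 : ∀ i j, (∃ v, B8 i j = X v) ∨ ∃ c, B8 i j = C c :=
    fun i j => pure_of_shape (big8 i j).2.2.1.2
  -- ### every realised symmetry of `per₃` is a monomial substitution of the variables
  have rm_mul : ∀ {ι : Type} [Fintype ι] [DecidableEq ι] {M N : Matrix ι ι ℂ},
      (∀ i, ∃ (j : ι) (c : ℂ), ∀ j', M i j' = if j' = j then c else 0) →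
      (∀ i, ∃ (j : ι) (c : ℂ), ∀ j', N i j' = if j' = j then c else 0) →
      ∀ i, ∃ (j : ι) (c : ℂ), ∀ j', (M * N) i j' = if j' = j then c else 0 := by
    intro ι _ _ M N hM hN i
    obtain ⟨j, c, hj⟩ := hM i
    obtain ⟨l, d, hl⟩ := hN j
    refine ⟨l, c * d, fun j' => ?_⟩
    simp only [Matrix.mul_apply, hj, ite_mul, zero_mul, Finset.sum_ite_eq', Finset.mem_univ, if_true,
      hl, mul_ite, mul_zero]
  have rm_diag : ∀ {ι : Type} [DecidableEq ι] (d : ι → ℂ),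
      ∀ i, ∃ (j : ι) (c : ℂ), ∀ j', Matrix.diagonal d i j' = if j' = j then c else 0 := by
    intro ι _ d i
    refine ⟨i, d i, fun j' => ?_⟩
    by_cases h : j' = i
    · subst h; simp
    · simp [h, Matrix.diagonal_apply_ne _ (Ne.symm h)]
  have rm_perm : ∀ {ι : Type} [DecidableEq ι] (π : Equiv.Perm ι),
      ∀ i, ∃ (j : ι) (c : ℂ), ∀ j', π.permMatrix ℂ i j' = if j' = j then c else 0 := fun π i =>
    ⟨π i, 1, fun j' => by simp [Equiv.Perm.permMatrix, PEquiv.toMatrix_apply, Equiv.toPEquiv_apply, eq_comm]⟩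
  have inv_perm : ∀ {ι : Type} [Fintype ι] [DecidableEq ι] (π : Equiv.Perm ι),
      (π.permMatrix ℂ)⁻¹ = π⁻¹.permMatrix ℂ := by
    intro ι _ _ π
    apply Matrix.inv_eq_right_inv
    rw [← Matrix.permMatrix_mul, inv_mul_cancel, Matrix.permMatrix_one]
  have rm_kron : ∀ {ι κ : Type} [DecidableEq ι] [DecidableEq κ] {M : Matrix ι ι ℂ},
      (∀ i, ∃ (j : ι) (c : ℂ), ∀ j', M i j' = if j' = j then c else 0) →
      (∀ i, ∃ (j : ι × κ) (c : ℂ), ∀ j', (M ⊗ₖ (1 : Matrix κ κ ℂ)) i j' = if j' = j then c else 0) ∧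
      (∀ i, ∃ (j : κ × ι) (c : ℂ), ∀ j', ((1 : Matrix κ κ ℂ) ⊗ₖ M) i j' = if j' = j then c else 0) := by
    intro ι κ _ _ M hM
    constructor
    · rintro ⟨i, k⟩
      obtain ⟨j, c, hj⟩ := hM i
      refine ⟨(j, k), c, ?_⟩
      rintro ⟨j', k'⟩
      simp only [Matrix.kronecker_apply, hj, Matrix.one_apply, Prod.mk.injEq]
      by_cases h1 : j' = j <;> by_cases h2 : k = k' <;> simp [h1, h2, eq_comm]
    · rintro ⟨k, i⟩
      obtain ⟨j, c, hj⟩ := hM i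
      refine ⟨(k, j), c, ?_⟩
      rintro ⟨k', j'⟩
      simp only [Matrix.kronecker_apply, hj, Matrix.one_apply, Prod.mk.injEq]
      by_cases h1 : j' = j <;> by_cases h2 : k = k' <;> simp [h1, h2, eq_comm]
  have rm_mono : ∀ {m : ℕ} {g : GL (Fin m) ℂ}, g ∈ monomialSubgroup ℂ m →
      ∀ i, ∃ (j : Fin m) (c : ℂ), ∀ j', (g : Matrix (Fin m) (Fin m) ℂ) i j' = if j' = j then c else 0 := by
    intro m g hg
    induction hg using Subgroup.closure_induction'' with
    | mem x hx =>
      rcases hx with ⟨π, hπ⟩ | ⟨d, hd⟩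
      · rw [hπ]; exact rm_perm π
      · rw [hd]; exact rm_diag d
    | inv_mem x hx =>
      rcases hx with ⟨π, hπ⟩ | ⟨d, hd⟩
      · rw [Matrix.coe_units_inv, hπ, inv_perm]; exact rm_perm _
      · rw [Matrix.coe_units_inv, hd, Matrix.inv_diagonal]; exact rm_diag _
    | one => simpa using rm_diag (fun _ : Fin m => (1 : ℂ))
    | mul x y _ _ hx hy => rw [Units.val_mul]; exact rm_mul hx hy
  have rm_symm : ∀ {γ : GL (Fin 3 × Fin 3) ℂ}, γ ∈ permSymmetrySubst ℂ 3 →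
      ∀ i, ∃ (j : Fin 3 × Fin 3) (c : ℂ), ∀ j',
        (γ : Matrix (Fin 3 × Fin 3) (Fin 3 × Fin 3) ℂ) i j' = if j' = j then c else 0 := by
    have hleft : ∀ {γ : GL (Fin 3 × Fin 3) ℂ}, γ ∈ leftMonomialSubst ℂ 3 →
        ∀ i, ∃ (j : Fin 3 × Fin 3) (c : ℂ), ∀ j',
          (γ : Matrix (Fin 3 × Fin 3) (Fin 3 × Fin 3) ℂ) i j' = if j' = j then c else 0 := by
      intro γ hγ
      induction hγ using Subgroup.closure_induction'' with
      | mem x hx =>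
        obtain ⟨g, hg, hx⟩ := hx
        rw [hx]; exact (rm_kron (rm_mono hg)).1
      | inv_mem x hx =>
        obtain ⟨g, hg, hx⟩ := hx
        rw [Matrix.coe_units_inv, hx, Matrix.inv_kronecker, inv_one, ← Matrix.coe_units_inv]
        exact (rm_kron (rm_mono (Subgroup.inv_mem _ hg))).1
      | one => simpa using rm_diag (fun _ : Fin 3 × Fin 3 => (1 : ℂ))
      | mul x y _ _ hx hy => rw [Units.val_mul]; exact rm_mul hx hy
    have hright : ∀ {γ : GL (Fin 3 × Fin 3) ℂ}, γ ∈ rightMonomialSubst ℂ 3 →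
        ∀ i, ∃ (j : Fin 3 × Fin 3) (c : ℂ), ∀ j',
          (γ : Matrix (Fin 3 × Fin 3) (Fin 3 × Fin 3) ℂ) i j' = if j' = j then c else 0 := by
      intro γ hγ
      induction hγ using Subgroup.closure_induction'' with
      | mem x hx =>
        obtain ⟨g, hg, hx⟩ := hx
        rw [hx]; exact (rm_kron (rm_mono hg)).2
      | inv_mem x hx =>
        obtain ⟨g, hg, hx⟩ := hx
        rw [Matrix.coe_units_inv, hx, Matrix.inv_kronecker, inv_one, ← Matrix.coe_units_inv]
        exact (rm_kron (rm_mono (Subgroup.inv_mem _ hg))).2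
      | one => simpa using rm_diag (fun _ : Fin 3 × Fin 3 => (1 : ℂ))
      | mul x y _ _ hx hy => rw [Units.val_mul]; exact rm_mul hx hy
    intro γ hγ
    induction hγ using Subgroup.closure_induction'' with
    | mem x hx =>
      rcases hx with (hx | hx) | hx
      · exact hleft hx
      · exact hright hx
      · have hx' : (x : Matrix (Fin 3 × Fin 3) (Fin 3 × Fin 3) ℂ) =
            Equiv.Perm.permMatrix ℂ (Equiv.prodComm (Fin 3) (Fin 3)) := hx
        rw [hx']; exact rm_perm _
    | inv_mem x hx =>
      rcases hx with (hx | hx) | hx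
      · exact hleft (Subgroup.inv_mem _ hx)
      · exact hright (Subgroup.inv_mem _ hx)
      · have hx' : (x : Matrix (Fin 3 × Fin 3) (Fin 3 × Fin 3) ℂ) =
            Equiv.Perm.permMatrix ℂ (Equiv.prodComm (Fin 3) (Fin 3)) := hx
        rw [Matrix.coe_units_inv, hx', inv_perm]; exact rm_perm _
    | one => simpa using rm_diag (fun _ : Fin 3 × Fin 3 => (1 : ℂ))
    | mul x y _ _ hx hy => rw [Units.val_mul]; exact rm_mul hx hy
  -- ### linear parts (coefficient matrices of the variables), now 8 × 8
  obtain ⟨lin, hlin⟩ : ∃ f : Fin 3 × Fin 3 → Matrix (Fin 8) (Fin 8) (MvPolynomial (Fin 3 × Fin 3) ℂ) →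
      Matrix (Fin 8) (Fin 8) ℂ, ∀ v M, f v M = Matrix.of fun i j => (M i j).coeff (Finsupp.single v 1) :=
    ⟨_, fun _ _ => rfl⟩
  have lin_C_mul : ∀ v (P : Matrix (Fin 8) (Fin 8) ℂ) M, lin v (P.map C * M) = P * lin v M := by
    intro v P M
    apply Matrix.ext; intro i j
    simp [hlin, Matrix.mul_apply, MvPolynomial.coeff_sum, MvPolynomial.coeff_C_mul]
  have lin_mul_C : ∀ v M (Q : Matrix (Fin 8) (Fin 8) ℂ), lin v (M * Q.map C) = lin v M * Q := by
    intro v M Q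
    apply Matrix.ext; intro i j
    have hc : ∀ (p : MvPolynomial (Fin 3 × Fin 3) ℂ) (a : ℂ),
        (p * C a).coeff (Finsupp.single v 1) = p.coeff (Finsupp.single v 1) * a := fun p a => by
      rw [mul_comm, MvPolynomial.coeff_C_mul, mul_comm]
    simp [hlin, Matrix.mul_apply, MvPolynomial.coeff_sum, hc]
  have lin_transpose : ∀ v M, lin v Mᵀ = (lin v M)ᵀ := fun v M => by
    apply Matrix.ext; intro i j; simp [hlin]
  have lin_subst : ∀ (Γ : Matrix (Fin 3 × Fin 3) (Fin 3 × Fin 3) ℂ) (v : Fin 3 × Fin 3),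
      lin v (A8.map (linSubst (Fin 3 × Fin 3) ℂ Γ)) = ∑ w, Γ v w • lin w A8 := by
    intro Γ v
    apply Matrix.ext; intro i j
    simp only [hlin, Matrix.map_apply, Matrix.of_apply, Matrix.sum_apply, Matrix.smul_apply, smul_eq_mul]
    rcases (big8 i j).2.2.1.1 with h | h | ⟨w, h⟩ <;> rw [h]
    · simp
    · simp [coeff_one_single]
    · simp [linSubst, MvPolynomial.coeff_sum, MvPolynomial.coeff_X, Finsupp.single_left_inj]
  -- ### rank at most two: factoring through `ℂ²`
  have rk_map : ∀ {N : Matrix (Fin 8) (Fin 8) ℂ} (P Q : Matrix (Fin 8) (Fin 8) ℂ) (c : ℂ),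
      (∃ (U : Matrix (Fin 8) (Fin 2) ℂ) (V : Matrix (Fin 2) (Fin 8) ℂ), N = U * V) →
      (∃ (U : Matrix (Fin 8) (Fin 2) ℂ) (V : Matrix (Fin 2) (Fin 8) ℂ), P * (c • N) * Q = U * V) ∧
      (∃ (U : Matrix (Fin 8) (Fin 2) ℂ) (V : Matrix (Fin 2) (Fin 8) ℂ), P * (c • N)ᵀ * Q = U * V) := by
    rintro N P Q c ⟨U, V, rfl⟩
    refine ⟨⟨P * (c • U), V * Q, ?_⟩, ⟨P * Vᵀ, (c • U)ᵀ * Q, ?_⟩⟩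
    · rw [← Matrix.smul_mul, Matrix.mul_assoc, Matrix.mul_assoc, Matrix.mul_assoc]
    · rw [← Matrix.smul_mul, Matrix.transpose_mul, Matrix.mul_assoc, Matrix.mul_assoc, Matrix.mul_assoc]
  have rk_rows : ∀ {N : Matrix (Fin 8) (Fin 8) ℂ} (p q : Fin 8), p ≠ q →
      (∀ i, i ≠ p → i ≠ q → ∀ j, N i j = 0) →
      ∃ (U : Matrix (Fin 8) (Fin 2) ℂ) (V : Matrix (Fin 2) (Fin 8) ℂ), N = U * V := by
    intro N p q hpq h
    refine ⟨Matrix.of fun i a => if a = 0 then (if i = p then 1 else 0) else (if i = q then 1 else 0),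
      Matrix.of fun a j => if a = 0 then N p j else N q j, ?_⟩
    apply Matrix.ext; intro i j
    simp only [Matrix.mul_apply, Fin.sum_univ_two, Matrix.of_apply, Fin.isValue, if_true, one_ne_zero,
      if_false]
    by_cases hip : i = p
    · subst hip; simp [hpq]
    · by_cases hiq : i = q
      · subst hiq; simp [hip]
      · simp [hip, hiq, h i hip hiq j]
  -- every linear part of `A₈ = G ⊕ 1` has at most two non-zero rows
  have rk_A8 : ∀ w, ∃ (U : Matrix (Fin 8) (Fin 2) ℂ) (V : Matrix (Fin 2) (Fin 8) ℂ), lin w A8 = U * V := by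
    intro w
    refine rk_rows (![![(0 : Fin 8), 2, 4], ![0, 1, 5], ![0, 1, 6]] w.1 w.2)
      (![![(1 : Fin 8), 3, 5], ![2, 3, 4], ![3, 2, 5]] w.1 w.2) ?_ fun i hp hq j => ?_
    · revert w; decide
    · rw [hlin, Matrix.of_apply]
      by_contra h
      rcases (big8 i j).2.2.2 w h with h' | h'
      exacts [hp h', hq h']
  -- the `X(2,1)`-linear part of `B₈` has an invertible `3 × 3` minor (rows `0,1,2`, columns `7,5,4`)
  have rk_B8 : ¬ ∃ (U : Matrix (Fin 8) (Fin 2) ℂ) (V : Matrix (Fin 2) (Fin 8) ℂ), lin (2,1) B8 = U * V := by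
    rintro ⟨U, V, hUV⟩
    have h1 : ((lin (2,1) B8).submatrix ![0, 1, 2] ![7, 5, 4]).det = 1 := by
      rw [hlin, hB8]; simp [Matrix.det_fin_three, MvPolynomial.coeff_X]
    have h2 : ((U * V).submatrix ![(0 : Fin 8), 1, 2] ![(7 : Fin 8), 5, 4]).det = 0 := by
      simp [Matrix.det_fin_three, Matrix.mul_apply, Fin.sum_univ_two]; ring
    rw [hUV, h2] at h1
    exact zero_ne_one h1
  -- ### conclusion
  obtain ⟨P, Q, γ, hγ, hPQ⟩ := hU 3 le_rfl 8 A8 B8 pure_A8 pure_B8 det_A8 det_B8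
  obtain ⟨w, c, hrow⟩ := rm_symm hγ (2,1)
  have key : lin (2,1) (Matrix.linSubstEntries γ A8) = c • lin w A8 := by
    rw [Matrix.linSubstEntries, lin_subst]
    simp only [hrow, ite_smul, zero_smul, Finset.sum_ite_eq', Finset.mem_univ, if_true]
  apply rk_B8
  rcases hPQ with hB | hB
  · rw [hB, lin_mul_C, lin_C_mul, key]
    exact (rk_map _ _ c (rk_A8 w)).1
  · rw [hB, lin_mul_C, lin_C_mul, lin_transpose, key]
    exact (rk_map _ _ c (rk_A8 w)).2

end Summit.ValiantsHypothesis.ValiantsHypothesis.Theorems.ProjOptimalUnique.Negative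

end
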